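import Literature.AnabelianGeometry.EtaleTheta.Thm56SubdagStatements
import Literature.AnabelianGeometry.EtaleTheta.Discharge.Sec5TransportLaws

/-!
# [EtTh] §5: the stub laws `LDeltaMapComp` / `LDeltaMapId` of a §5 datum REDUCE to its theta-subquotient stub — and HOLD
# whenever that stub is abc-iut-L2-t9's R2 instance `thetaSubquotientStub q ι`

Mochizuki, *The étale theta function and its Frobenioid-theoretic manifestations*, Publ. RIMS **45** (2009), §5 p. 327 (PDF
p. 101) ("these subquotients determine subquotients … `(l·Δ_Θ)_D ⊆ Aut^Θ_D(D)`"), Prop. 5.5 proof p. 328 (PDF p. 102) (transport of the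
subquotients along linear morphisms, used compositionally).  [cite: MochizukiEtTh2009, §5 p.327–328 (PDF pp.101–102)]
abc-iut cell, layer L2, seat abc-iut-L2-t9 (gen 3; unit W2-L2-05 lineage).  PROOF-ONLY (no `def`); nothing landed is edited or restated.

WHY.  abc-iut-w5-d020's sub-DAG predicates `Thm56Sub.LDeltaMapComp 𝔉` / `Thm56Sub.LDeltaMapId 𝔉` (P55-L06b laws 3–4,
`Thm56SubdagStatements.lean`) are BINDERS `hLc` / `hLi` of the Thm. 5.6 capstones at the genuine data (`Sec5Thm56Capstone`,
`Sec5Thm56OfConnectedTemperoidData…`) for a FREE subquotient stub `Q`, and "stub laws LDeltaMapComp/Id of `Q`" is a residual named input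
of plan/L2 SUBDAG-EtTh-Thm56 v3.1.  For EVERY §5 datum whose field `toThetaSubquotientStub` is abc-iut-L2-t9's R2 instance
`ThetaSubquotient.thetaSubquotientStub q ι` — abc-iut-L2-t4's `ofThetaSettingDataQ` (`Q := ofSettingSub D l C.Huu`,
`ofThetaSettingDataQ_toThetaSubquotientStub`, `rfl`) and abc-iut-w4-d042's level-`N` data (`Q := RD.levelStub ιX`,
`ofConnectedTemperoidData_levelN_stub`, `rfl`) — the two laws HOLD by abc-iut-w5-d020's `thetaSubquotientStub_lDeltaMap_comp/_id`
(p418890).  The reduction is stated so that a consumer passes its own `rfl`-level identification of the stub and never unfolds the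
definitional stack of the data (cf. the elaboration notes of `Sec5Prop55OfConnectedTemperoidLevelN`).

WHAT IS PROVED.
* `Thm56Sub.lDeltaMapComp_iff_of_stub_eq` / `lDeltaMapId_iff_of_stub_eq` — for `𝔉.toThetaSubquotientStub = Q`, the laws of `𝔉` ARE the
  laws of `Q` (pure bookkeeping, any base `D`);
* **`Thm56Sub.lDeltaMapComp_of_stub_eq_thetaSubquotientStub` / `lDeltaMapId_of_stub_eq_thetaSubquotientStub`** — over `D = B^temp(Π)⁰`, if
  `𝔉.toThetaSubquotientStub = thetaSubquotientStub q ι` then `LDeltaMapComp 𝔉` and `LDeltaMapId 𝔉` HOLD (any `Π`, `q`, `ι` with normal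
  image): the binders `hLc` / `hLi` are DISCHARGED for every such datum, in particular for both pinned data at the Setting
  (`ofSettingSub`, `levelStub`).

HONEST FRAMING: generic facts about abc-iut-L2-t9's carrier and abc-iut-L2-t4's data structure; nothing is asserted about [EtTh]'s
curves; [EtTh] is refereed and nothing here bears on [IUTchIII] Cor. 3.12 — no side is taken; typed ≠ proved.
-/

namespace Literature.AnabelianGeometry.EtaleTheta

namespace ThetaFrobenioid

namespace Thm56Sub

open CategoryTheory Literature.AlgebraicGeometry.Frobenioids Literature.AnabelianGeometry.SemiGraphs

universe w v v' u u'

/-! ### The laws of the data are the laws of its stub -/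

section AnyBase

variable {C : Type u} [Category.{v} C] {D : Type u'} [Category.{v'} D] (𝔉 : ThetaFrobenioid.{w} C D)
  (Q : FrobenioidTheta.ThetaSubquotientStub.{w} D)

/-- `LDeltaMapComp 𝔉` is the composition law of the stub `𝔉.toThetaSubquotientStub`; so if that stub IS `Q`, it is the composition
law of `Q`. [cite: MochizukiEtTh2009, §5 p.327 (PDF p.101)] -/
theorem lDeltaMapComp_iff_of_stub_eq (hQ : 𝔉.toThetaSubquotientStub = Q) :
    LDeltaMapComp 𝔉 ↔
      ∀ {E E' E'' : D} (f : E ⟶ E') (g : E' ⟶ E''), Q.lDeltaMap (f ≫ g) = (Q.lDeltaMap g).comp (Q.lDeltaMap f) := by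
  subst hQ; exact Iff.rfl

/-- Likewise for the identity law. [cite: MochizukiEtTh2009, §5 p.327 (PDF p.101)] -/
theorem lDeltaMapId_iff_of_stub_eq (hQ : 𝔉.toThetaSubquotientStub = Q) :
    LDeltaMapId 𝔉 ↔ ∀ E : D, Q.lDeltaMap (𝟙 E) = MonoidHom.id _ := by
  subst hQ; exact Iff.rfl

end AnyBase

/-! ### … and the laws of abc-iut-L2-t9's R2 instance hold -/

section Tempered

variable {C : Type u} [Category.{v} C] {G : Type u'} [Group G] [TopologicalSpace G]
  {Q' : Type v'} [Group Q'] {Λ : Type w} [CommGroup Λ] (q : G →* Q') (ι : Λ →* Q') [ι.range.Normal]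
  (𝔉 : ThetaFrobenioid.{max u' w} C (ConnectedPart (BTemp G)))

/-- **`hLc` DISCHARGED**: a §5 datum over `B^temp(Π)⁰` whose theta-subquotient stub is abc-iut-L2-t9's `thetaSubquotientStub q ι`
satisfies `LDeltaMapComp` (abc-iut-w5-d020's `thetaSubquotientStub_lDeltaMap_comp`, p418890).
[cite: MochizukiEtTh2009, §5 p.327 (PDF p.101)] -/
theorem lDeltaMapComp_of_stub_eq_thetaSubquotientStub
    (h𝔉 : 𝔉.toThetaSubquotientStub = ThetaSubquotient.thetaSubquotientStub q ι) : LDeltaMapComp 𝔉 :=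
  (lDeltaMapComp_iff_of_stub_eq 𝔉 _ h𝔉).2 fun f g => ThetaSubquotient.thetaSubquotientStub_lDeltaMap_comp q ι f g

/-- **`hLi` DISCHARGED**: likewise `LDeltaMapId` (abc-iut-w5-d020's `thetaSubquotientStub_lDeltaMap_id`).
[cite: MochizukiEtTh2009, §5 p.327 (PDF p.101)] -/
theorem lDeltaMapId_of_stub_eq_thetaSubquotientStub
    (h𝔉 : 𝔉.toThetaSubquotientStub = ThetaSubquotient.thetaSubquotientStub q ι) : LDeltaMapId 𝔉 :=
  (lDeltaMapId_iff_of_stub_eq 𝔉 _ h𝔉).2 fun E => ThetaSubquotient.thetaSubquotientStub_lDeltaMap_id q ι E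

/-- Both laws at once, as the pair of binders `(hLc, hLi)` of the Thm. 5.6 capstones. [cite: MochizukiEtTh2009, §5 p.327 (PDF p.101)] -/
theorem lDeltaMapLaws_of_stub_eq_thetaSubquotientStub
    (h𝔉 : 𝔉.toThetaSubquotientStub = ThetaSubquotient.thetaSubquotientStub q ι) : LDeltaMapComp 𝔉 ∧ LDeltaMapId 𝔉 :=
  ⟨lDeltaMapComp_of_stub_eq_thetaSubquotientStub q ι 𝔉 h𝔉, lDeltaMapId_of_stub_eq_thetaSubquotientStub q ι 𝔉 h𝔉⟩

end Tempered

end Thm56Sub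

end ThetaFrobenioid

end Literature.AnabelianGeometry.EtaleTheta
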